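import Summits.QuantumFields.YangMills.Theses.EntropyBudgetEquipartition
import Summits.QuantumFields.YangMills.Theorems.EntropyBudgetEquipartitionFreeEnergyRate
import Summits.QuantumFields.YangMills.Theorems.SourcedPressureJensenJensenFloor
import HarnessLib

/-!
# Route `EntropyBudgetEquipartition`, crux `EntropyBudgetTransfer` (stmt-QuantumFields-22401) — the crux IS its conclusion, and it follows from the TWO-SIGNED sourced pressure increment

HONEST LABEL: helper lemmas toward a RECORD-label rung (R2ξ-G, `WeakCouplingRates.XiPow`, an UPPER bound on the lattice gap);
nothing here bears on the Clay Yang–Mills mass gap, which is NOT proved by any of this.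

Two structural facts about the deciding crux `EntropyBudgetTransfer` (K1's body ⇒ the TWO-SIDED free-gluon law
`|β²·Cov_{β,Λ_{L+1}}(c₀, c_{n e₀}) − σ·C(n)²| ≤ C β^(−κ)` for `1 ≤ n ≤ 2β^A`, eventually in `L`):

* `entropyBudgetTransfer_iff_twoSidedLaw` — its hypothesis (the body of the crux `FreeEnergyRate`) is PROVED in the tree
  (`FreeEnergyRate.FreeEnergyRate_of`), so the item is equivalent to its bare conclusion, the two-sided law at every `(G, r)`.
* `twoSidedLaw_of_twoSignedSource` / `entropyBudgetTransfer_of_twoSignedSource` — the two-sided law follows from the sourced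
  pressure increment bound of the sibling route `SourcedPressureJensen` (crux `SourcedPressureIncrement`, stmt-QuantumFields-22517)
  taken for BOTH SIGNS of the source strength `h` with a COMMON Gaussian constant `σ`:
  `|Λ|⁻¹ log E exp(−h H_{n,Λ}) ≤ −h σ C(n)² + C β^(−κ) + M h²` for `0 < |h| ≤ h₀`, where
  `H_{n,Λ} = Σ_x (β c(x) − β⟨c⟩)(β c(x + n e₀) − β⟨c⟩)`.  Jensen on the torus (`stub_jensen`, landed for the crux `JensenFloor`,
  valid for every real `h`) gives `−h E[H] ≤ log E e^{−hH}`; at `h = +β^(−κ/2)` this is the LOWER law (exactly `JensenFloor_of`),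
  at `h = −β^(−κ/2)` the UPPER law, and `|Λ|⁻¹ E[H] = β² Cov` (`stub_centredSum`).  So the idle upper half of the crux
  (`floorOfLocalLaw_proof` uses only the lower half) is precisely the negative-`h` sourced pressure increment; with `κ' = κ/2`,
  `C' = |C| + |M|`, `β₁ = max β₀ (max 1 (h₀^(−2/κ)))`.

No new definitions; the two-signed hypothesis is spelled out in the binder. [folklore]
-/

noncomputable section

namespace Summit.QuantumFields.YangMills.Theorems.EntropyBudgetEquipartition.TwoSignedSource

open MeasureTheory Filter
open Literature.MathematicalPhysics.QuantumFieldTheory Literature.MathematicalPhysics.QuantumLattice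
  Summit.QuantumFields.YangMills.Theorems.WeakCouplingRates
  Summit.QuantumFields.YangMills.Cruxes.JensenFloor.Birth

/-! ### Real arithmetic core -/

/-- The two-signed squeeze: Jensen at `h = ±η` (`jp`, `jm`), the sourced bounds at `h = ±η` after multiplying by the
volume factor (`hp`, `hm`), and the centring identity `V·E = β²·X` give `|β² X − σ S| ≤ (|C| + |M|) η` once
`η² = ε` is the slack. [folklore] -/
theorem abs_sub_le_of_twoSigned {V E Pp Pm X S σ C M η ε β : ℝ} (hV : 0 < V) (hη : 0 < η) (hsq : η * η = ε)
    (jp : -η * E ≤ Pp) (jm : η * E ≤ Pm)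
    (hp : V * Pp ≤ -η * (σ * S) + C * ε + M * η ^ 2)
    (hm : V * Pm ≤ η * (σ * S) + C * ε + M * η ^ 2)
    (c : V * E = β ^ 2 * X) :
    |β ^ 2 * X - σ * S| ≤ (|C| + |M|) * η := by
  have jp' : V * (-η * E) ≤ V * Pp := mul_le_mul_of_nonneg_left jp hV.le
  have jm' : V * (η * E) ≤ V * Pm := mul_le_mul_of_nonneg_left jm hV.le
  have e1 : V * (-η * E) = -η * (β ^ 2 * X) := by rw [← c]; ring
  have e2 : V * (η * E) = η * (β ^ 2 * X) := by rw [← c]; ring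
  rw [← hsq] at hp hm
  -- lower: -η β²X ≤ -η σ S + (C+M) η²  ⇒  σ S - (C+M) η ≤ β² X
  have low1 : η * (σ * S - (C + M) * η) ≤ η * (β ^ 2 * X) := by nlinarith
  have low : σ * S - (C + M) * η ≤ β ^ 2 * X := le_of_mul_le_mul_left low1 hη
  -- upper: η β²X ≤ η σ S + (C+M) η²  ⇒  β² X ≤ σ S + (C+M) η
  have up1 : η * (β ^ 2 * X) ≤ η * (σ * S + (C + M) * η) := by nlinarith
  have up : β ^ 2 * X ≤ σ * S + (C + M) * η := le_of_mul_le_mul_left up1 hη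
  have hCM : (C + M) * η ≤ (|C| + |M|) * η := by
    apply mul_le_mul_of_nonneg_right _ hη.le
    linarith [le_abs_self C, le_abs_self M]
  rw [abs_le]
  constructor <;> linarith

/-! ### The two-sided law from the two-signed sourced pressure increment, at one `(G, r)` -/

/-- **Two-sided free-gluon law from the two-signed sourced pressure increment** (pointwise in the gauge group `G` and the lattice
representation `r`).  If for `β ≥ β₀`, `1 ≤ n ≤ 2β^A` and every `h` with `0 < |h| ≤ h₀`, eventually in the torus size,
`|Λ_{L+1}|⁻¹ log E_{β,L+1} exp(−h H_{n,Λ}) ≤ −h σ C(n)² + C β^(−κ) + M h²` (the body of `SourcedPressureIncrement` with both signs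
of `h` and one `σ`), then `|β² Cov_{β,L+1}(c₀, c_{n e₀}) − σ C(n)²| ≤ (|C| + |M|) β^(−κ/2)` for `β ≥ max β₀ (max 1 (h₀^(−2/κ)))`,
`1 ≤ n ≤ 2β^A`, eventually in `L` — Jensen `−h E[H] ≤ log E e^{−hH}` at `h = ±β^(−κ/2)` (`stub_jensen`) and
`|Λ|⁻¹ E[H] = β² Cov` (`stub_centredSum`). [folklore] -/
theorem twoSidedLaw_of_twoSignedSource (G : Type) [Group G] [TopologicalSpace G] [IsTopologicalGroup G] [CompactSpace G]
    [MeasurableSpace G] [BorelSpace G] (r : LatticeRep G)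
    (hKS : ∃ κ A M C σ h₀ β₀ : ℝ, 0 < κ ∧ 0 < A ∧ 0 < σ ∧ 0 < h₀ ∧ ∀ β : ℝ, β₀ ≤ β → ∀ n : ℕ, 1 ≤ n → (n : ℝ) ≤ 2 * β ^ A →
      ∀ h : ℝ, h ≠ 0 → |h| ≤ h₀ → ∀ᶠ L : ℕ in Filter.atTop,
        ((L + 1 : ℝ) ^ 4)⁻¹ * Real.log (wilsonExpectation (L := L + 1) r.ρ β fun U => Real.exp (-h * ∑ x : Fin 4 → Fin (L + 1),
          toTorusObservable (L + 1) (fun V => (β * plaqCost0 (d := 4) r.ρ 1 2 (configShift (fun i => -((x i : ℕ) : ℤ)) V) -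
            β * wilsonExpectation (L := L + 1) r.ρ β (toTorusObservable (L + 1) (plaqCost0 (d := 4) r.ρ 1 2))) *
            (β * plaqCost0 (d := 4) r.ρ 1 2 (timeShiftLG (G := G) n (configShift (fun i => -((x i : ℕ) : ℤ)) V)) -
              β * wilsonExpectation (L := L + 1) r.ρ β (toTorusObservable (L + 1) (plaqCost0 (d := 4) r.ρ 1 2)))) U)) ≤
          -h * (σ * (curvaturePlaquetteCorr (d := 4) (by norm_num) (n : ℤ)) ^ 2) + C * β ^ (-κ) + M * h ^ 2) :
    ∃ κ A C σ β₀ : ℝ, 0 < κ ∧ 0 < A ∧ 0 < σ ∧ ∀ β : ℝ, β₀ ≤ β → ∀ n : ℕ, 1 ≤ n → (n : ℝ) ≤ 2 * β ^ A →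
      ∀ᶠ L : ℕ in Filter.atTop, |β ^ 2 * (wilsonExpectation (L := L + 1) r.ρ β (toTorusObservable (L + 1) fun U =>
          plaqCost0 (d := 4) r.ρ 1 2 U * plaqCost0 (d := 4) r.ρ 1 2 (timeShiftLG (G := G) n U)) -
        wilsonExpectation (L := L + 1) r.ρ β (toTorusObservable (L + 1) (plaqCost0 (d := 4) r.ρ 1 2)) *
          wilsonExpectation (L := L + 1) r.ρ β (toTorusObservable (L + 1) fun U =>
            plaqCost0 (d := 4) r.ρ 1 2 (timeShiftLG (G := G) n U))) -
        σ * (curvaturePlaquetteCorr (d := 4) (by norm_num) (n : ℤ)) ^ 2| ≤ C * β ^ (-κ) := by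
  obtain ⟨κ, A, M, C, σ, h₀, β₀, hκ, hA, hσ, hh₀, hmain⟩ := hKS
  refine ⟨κ / 2, A, |C| + |M|, σ, max β₀ (max 1 (h₀ ^ (-(2 / κ)))), by positivity, hA, hσ, ?_⟩
  intro β hβ n hn1 hn2
  have hβ₀ : β₀ ≤ β := le_trans (le_max_left _ _) hβ
  have hβ1 : (1 : ℝ) ≤ β := le_trans (le_trans (le_max_left _ _) (le_max_right _ _)) hβ
  have hβB : h₀ ^ (-(2 / κ)) ≤ β := le_trans (le_trans (le_max_right _ _) (le_max_right _ _)) hβ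
  have hβpos : 0 < β := by linarith
  have hpos : 0 < β ^ (-(κ / 2)) := Real.rpow_pos_of_pos hβpos _
  have hle : β ^ (-(κ / 2)) ≤ h₀ := rpow_half_le hκ hh₀ hβB
  have hsq : β ^ (-(κ / 2)) * β ^ (-(κ / 2)) = β ^ (-κ) := rpow_half_mul_half hβpos
  have habs_p : |β ^ (-(κ / 2))| ≤ h₀ := by rwa [abs_of_pos hpos]
  have habs_m : |-(β ^ (-(κ / 2)))| ≤ h₀ := by rwa [abs_neg, abs_of_pos hpos]
  have evp := hmain β hβ₀ n hn1 hn2 (β ^ (-(κ / 2))) hpos.ne' habs_p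
  have evm := hmain β hβ₀ n hn1 hn2 (-(β ^ (-(κ / 2)))) (neg_ne_zero.mpr hpos.ne') habs_m
  filter_upwards [evp, evm] with L hLp hLm
  have jp := stub_jensen G r β n (β ^ (-(κ / 2))) L
  have jm := stub_jensen G r β n (-(β ^ (-(κ / 2)))) L
  have c := stub_centredSum G r β n L
  -- abbreviate the real numbers in play
  generalize hE : wilsonExpectation (L := L + 1) r.ρ β (fun U =>
              ∑ x : Fin 4 → Fin (L + 1),
                toTorusObservable (L + 1)
                  (fun V =>
                    (β * plaqCost0 (d := 4) r.ρ 1 2 (configShift (fun i => -((x i : ℕ) : ℤ)) V) -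
                        β * wilsonExpectation (L := L + 1) r.ρ β
                          (toTorusObservable (L + 1) (plaqCost0 (d := 4) r.ρ 1 2))) *
                      (β * plaqCost0 (d := 4) r.ρ 1 2
                          (timeShiftLG (G := G) n (configShift (fun i => -((x i : ℕ) : ℤ)) V)) -
                        β * wilsonExpectation (L := L + 1) r.ρ β
                          (toTorusObservable (L + 1) (plaqCost0 (d := 4) r.ρ 1 2))))
                  U) = E at jp jm c
  generalize hPp : Real.log
            (wilsonExpectation (L := L + 1) r.ρ β fun U =>
              Real.exp
                (-(β ^ (-(κ / 2))) *
                  ∑ x : Fin 4 → Fin (L + 1),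
                    toTorusObservable (L + 1)
                      (fun V =>
                        (β * plaqCost0 (d := 4) r.ρ 1 2 (configShift (fun i => -((x i : ℕ) : ℤ)) V) -
                            β * wilsonExpectation (L := L + 1) r.ρ β
                              (toTorusObservable (L + 1) (plaqCost0 (d := 4) r.ρ 1 2))) *
                          (β * plaqCost0 (d := 4) r.ρ 1 2
                              (timeShiftLG (G := G) n (configShift (fun i => -((x i : ℕ) : ℤ)) V)) -
                            β * wilsonExpectation (L := L + 1) r.ρ β
                              (toTorusObservable (L + 1) (plaqCost0 (d := 4) r.ρ 1 2))))
                      U)) = Pp at jp hLp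
  generalize hPm : Real.log
            (wilsonExpectation (L := L + 1) r.ρ β fun U =>
              Real.exp
                (-(-(β ^ (-(κ / 2)))) *
                  ∑ x : Fin 4 → Fin (L + 1),
                    toTorusObservable (L + 1)
                      (fun V =>
                        (β * plaqCost0 (d := 4) r.ρ 1 2 (configShift (fun i => -((x i : ℕ) : ℤ)) V) -
                            β * wilsonExpectation (L := L + 1) r.ρ β
                              (toTorusObservable (L + 1) (plaqCost0 (d := 4) r.ρ 1 2))) *
                          (β * plaqCost0 (d := 4) r.ρ 1 2
                              (timeShiftLG (G := G) n (configShift (fun i => -((x i : ℕ) : ℤ)) V)) -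
                            β * wilsonExpectation (L := L + 1) r.ρ β
                              (toTorusObservable (L + 1) (plaqCost0 (d := 4) r.ρ 1 2))))
                      U)) = Pm at jm hLm
  generalize hX : (wilsonExpectation (L := L + 1) r.ρ β
                (toTorusObservable (L + 1) fun U =>
                  plaqCost0 (d := 4) r.ρ 1 2 U * plaqCost0 (d := 4) r.ρ 1 2 (timeShiftLG (G := G) n U)) -
              wilsonExpectation (L := L + 1) r.ρ β (toTorusObservable (L + 1) (plaqCost0 (d := 4) r.ρ 1 2)) *
                wilsonExpectation (L := L + 1) r.ρ β
                  (toTorusObservable (L + 1) fun U => plaqCost0 (d := 4) r.ρ 1 2 (timeShiftLG (G := G) n U))) = X at c ⊢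
  generalize hS : (curvaturePlaquetteCorr (d := 4) (by norm_num) (n : ℤ)) ^ 2 = S at hLp hLm ⊢
  generalize hh : β ^ (-(κ / 2)) = η at hpos hsq jp jm hLp hLm ⊢
  have hV : (0 : ℝ) < ((L + 1 : ℝ) ^ 4)⁻¹ := by positivity
  have jm' : η * E ≤ Pm := by simpa only [neg_neg] using jm
  have hLm' : ((L + 1 : ℝ) ^ 4)⁻¹ * Pm ≤ η * (σ * S) + C * β ^ (-κ) + M * η ^ 2 := by
    have e : -(-η) * (σ * S) + C * β ^ (-κ) + M * (-η) ^ 2 = η * (σ * S) + C * β ^ (-κ) + M * η ^ 2 := by ring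
    rw [← e]; exact hLm
  exact abs_sub_le_of_twoSigned hV hpos hsq jp jm' hLp hLm' c

/-! ### Consequences for the crux `EntropyBudgetTransfer` -/

/-- **`EntropyBudgetTransfer` from the two-signed sourced pressure increment.**  If at every compact simple `G` and lattice
representation `r` the sourced pressure increment bound holds for both signs of `h` with a common `σ` (hypothesis, spelled out), then
the crux `EntropyBudgetTransfer` of route `EntropyBudgetEquipartition` holds (its K1 hypothesis is not even used).  A reduction of a
RECORD-label rung crux; NOT the Clay mass gap. [folklore] -/
theorem entropyBudgetTransfer_of_twoSignedSource
    (hKS : ∀ (G : Type) [Group G] [TopologicalSpace G] [IsTopologicalGroup G] [CompactSpace G], IsCompactSimpleLieGroup G →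
      letI : MeasurableSpace G := borel G; haveI : BorelSpace G := ⟨rfl⟩; ∀ r : LatticeRep G,
      ∃ κ A M C σ h₀ β₀ : ℝ, 0 < κ ∧ 0 < A ∧ 0 < σ ∧ 0 < h₀ ∧ ∀ β : ℝ, β₀ ≤ β → ∀ n : ℕ, 1 ≤ n → (n : ℝ) ≤ 2 * β ^ A →
      ∀ h : ℝ, h ≠ 0 → |h| ≤ h₀ → ∀ᶠ L : ℕ in Filter.atTop,
        ((L + 1 : ℝ) ^ 4)⁻¹ * Real.log (wilsonExpectation (L := L + 1) r.ρ β fun U => Real.exp (-h * ∑ x : Fin 4 → Fin (L + 1),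
          toTorusObservable (L + 1) (fun V => (β * plaqCost0 (d := 4) r.ρ 1 2 (configShift (fun i => -((x i : ℕ) : ℤ)) V) -
            β * wilsonExpectation (L := L + 1) r.ρ β (toTorusObservable (L + 1) (plaqCost0 (d := 4) r.ρ 1 2))) *
            (β * plaqCost0 (d := 4) r.ρ 1 2 (timeShiftLG (G := G) n (configShift (fun i => -((x i : ℕ) : ℤ)) V)) -
              β * wilsonExpectation (L := L + 1) r.ρ β (toTorusObservable (L + 1) (plaqCost0 (d := 4) r.ρ 1 2)))) U)) ≤
          -h * (σ * (curvaturePlaquetteCorr (d := 4) (by norm_num) (n : ℤ)) ^ 2) + C * β ^ (-κ) + M * h ^ 2) :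
    Summit.QuantumFields.YangMills.Theses.EntropyBudgetEquipartition.EntropyBudgetTransfer := by
  intro G _ _ _ _ hG
  letI : MeasurableSpace G := borel G
  haveI : BorelSpace G := ⟨rfl⟩
  intro r _
  exact twoSidedLaw_of_twoSignedSource G r (hKS G hG r)

/-- **The crux is its conclusion.**  Since the body of `FreeEnergyRate` is PROVED for every compact simple `G` and lattice
representation `r` (`FreeEnergyRate.FreeEnergyRate_of`), `EntropyBudgetTransfer` is equivalent to the bare two-sided free-gluon law
`∃ κ A C σ β₀, … |β² Cov_{β,L+1}(c₀, c_{n e₀}) − σ C(n)²| ≤ C β^(−κ)` (for `1 ≤ n ≤ 2β^A`, eventually in `L`) at every `(G, r)`.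
A RECORD-label rung crux; NOT the Clay mass gap. [folklore] -/
theorem entropyBudgetTransfer_iff_twoSidedLaw :
    Summit.QuantumFields.YangMills.Theses.EntropyBudgetEquipartition.EntropyBudgetTransfer ↔
      ∀ (G : Type) [Group G] [TopologicalSpace G] [IsTopologicalGroup G] [CompactSpace G], IsCompactSimpleLieGroup G →
        letI : MeasurableSpace G := borel G; haveI : BorelSpace G := ⟨rfl⟩; ∀ r : LatticeRep G,
        ∃ κ A C σ β₀ : ℝ, 0 < κ ∧ 0 < A ∧ 0 < σ ∧ ∀ β : ℝ, β₀ ≤ β → ∀ n : ℕ, 1 ≤ n → (n : ℝ) ≤ 2 * β ^ A →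
          ∀ᶠ L : ℕ in Filter.atTop, |β ^ 2 * (wilsonExpectation (L := L + 1) r.ρ β (toTorusObservable (L + 1) fun U =>
              plaqCost0 (d := 4) r.ρ 1 2 U * plaqCost0 (d := 4) r.ρ 1 2 (timeShiftLG (G := G) n U)) -
            wilsonExpectation (L := L + 1) r.ρ β (toTorusObservable (L + 1) (plaqCost0 (d := 4) r.ρ 1 2)) *
              wilsonExpectation (L := L + 1) r.ρ β (toTorusObservable (L + 1) fun U =>
                plaqCost0 (d := 4) r.ρ 1 2 (timeShiftLG (G := G) n U))) -
            σ * (curvaturePlaquetteCorr (d := 4) (by norm_num) (n : ℤ)) ^ 2| ≤ C * β ^ (-κ) := by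
  constructor
  · intro h G _ _ _ _ hG
    letI : MeasurableSpace G := borel G
    haveI : BorelSpace G := ⟨rfl⟩
    intro r
    exact h G hG r (Summit.QuantumFields.YangMills.Theorems.FreeEnergyRate.FreeEnergyRate_of G hG r)
  · intro h G _ _ _ _ hG
    letI : MeasurableSpace G := borel G
    haveI : BorelSpace G := ⟨rfl⟩
    intro r _
    exact h G hG r

end Summit.QuantumFields.YangMills.Theorems.EntropyBudgetEquipartition.TwoSignedSource

end
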